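import Summits.SmoothPoincare4.SmoothPoincare4.Theorems.ConvexBisectionAcyclicBisectionExistsPageTube
import Summits.SmoothPoincare4.SmoothPoincare4.Theorems.ConvexBisectionAcyclicBisectionExistsChartRegularity
import Summits.SmoothPoincare4.SmoothPoincare4.Theorems.ConvexBisectionAcyclicBisectionExistsBeltCoreTwistingLoop
import Summits.SmoothPoincare4.SmoothPoincare4.Theorems.ConvexBisectionAcyclicBisectionExistsEmbeddedShadowPrimitive
import Literature.Topology.FourManifolds.LefschetzHandlebody
import Literature.Geometry.Symplectic.AttachingCircleProofs
import HarnessLib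

/-!
# Every smoothly embedded page curve admits a positively oriented smooth annulus chart (node N3b″)
(wave 6, brick G7-5 for node N3b `node_STembed` of stub `stub_STgeo` = N3 of NF4
`stub_modelsOnFibred_of_reach`, line `modp-braid-orbits`, crux `ConvexBisection.AcyclicBisectionExists`,
item stmt-SmoothPoincare4-10508; registered sub-goal `helper_exists_chart_of_isSmoothEmbedding`)

The crossing-number machinery of node N1a (Picard–Lefschetz on shadows, `crossingNumber_eq_stdSymp`)
and the repair lemma N3b′ (`shadow_eq_zero_or_isPrimitive`, G7-3) take an embedded page curve in the
form of an ANNULUS CHART `φ : ℝ × ℝ → Base g` with six clauses (smooth, `1`-periodic, core, page-valued,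
injective on `[0, 1) × (−1, 1)`, `0 < ⟪∂ᵣφ, i ∂ᵤφ⟫`).  This file produces such a chart for EVERY smooth
embedding `K : 𝕊¹ → Base g` into a page `page g c` (`exists_chart_of_isSmoothEmbedding`), from Z4's
page-adapted circle tube `Φ` (`helper_exists_pageTube`, p146212: first fibre direction inside the page
of `K`, fibre derivative `r · iK'` at the zero section, `r > 0`):

  `φ (u, x) = incl (Φ (e^{2πiu}, (2/π) arctan (ε x) • e₀))`,

where the squashing `arctan` makes `φ` global, smooth and page-valued, and `ε > 0` is so small that the
orientation pairing `⟪∂ₓφ₀, i ∂ᵤφ₀⟫` of the un-thinned chart `φ₀` — continuous (`continuous_fderiv_val`,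
Z6-9), `1`-periodic in `u`, and equal to `(2/π) r ‖K'‖² > 0` on the zero section
(`deriv_ambCurve_ne_zero`) — stays positive on `ℝ × (−ε, ε)` (generalized tube lemma).

Consequences: `shadow_eq_zero_or_isPrimitive_of_isSmoothEmbedding` (N3b′ for smoothly embedded page
curves) and **`IsLefschetzLink.fst_eq_zero_or_isPrimitive`**: every letter of a word realised by a
Lefschetz link over `Base g` is `0` or primitive.  Everything is proved; no definitions, no named
facts, no `sorry`.  References: A. A. Kosinski, *Differential Manifolds* (1993), III (3.1) (tubular
neighbourhoods of circles) [Kosinski1993]; B. Farb, D. Margalit, *A primer on mapping class groups*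
(2012), Prop. 6.2 [FarbMargalit2012].
-/

noncomputable section

set_option linter.dupNamespace false

open scoped Manifold ContDiff Topology Real
open Set Function Metric
open Literature.Topology.FourManifolds Literature.Topology.FourManifolds.LefschetzBase
  Literature.GroupTheory.CombinatorialGroupTheory.SignedHurwitz Literature.Geometry.Symplectic

namespace Summit.SmoothPoincare4.SmoothPoincare4.Theorems.AcyclicBisectionExists.ModpBraidOrbits

variable {g : ℕ} {c : ℂ} {K : sphere (0 : EuclideanSpace ℝ (Fin 2)) 1 → Base g}

/-! ## §1 The chart -/

/-- **Every smoothly embedded page curve admits a positively oriented smooth annulus chart** (the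
six hypotheses of node N1a): for a smooth embedding `K : 𝕊¹ → Base g` into `page g c` (`‖c‖ = 1`)
there is `φ : ℝ × ℝ → Base g`, smooth, `1`-periodic in `u`, with `φ (u, 0) = K (e^{2πiu})`, values in
`page g c`, injective on `[0, 1) × (−1, 1)`, and `0 < ⟪∂ᵣφ, i ∂ᵤφ⟫` for `r ∈ (−1, 1)`.
[cite: Kosinski1993, III (3.1)] -/
theorem exists_chart_of_isSmoothEmbedding (hc : ‖c‖ = 1)
    (hK : Manifold.IsSmoothEmbedding (𝓡 1) (𝓡∂ 4) ∞ K) (hKc : ∀ θ, K θ ∈ page g c) :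
    ∃ φ : ℝ × ℝ → Base g, ContMDiff 𝓘(ℝ, ℝ × ℝ) (𝓡∂ 4) ∞ φ ∧ (∀ u r, φ (u + 1, r) = φ (u, r)) ∧
      (∀ u, φ (u, 0) = K (circlePt u)) ∧ (∀ p, φ p ∈ page g c) ∧
      InjOn φ (Ico (0 : ℝ) 1 ×ˢ Ioo (-1 : ℝ) 1) ∧
      ∀ u r, r ∈ Ioo (-1 : ℝ) 1 →
        0 < inner ℝ (deriv (fun r' => (φ (u, r')).1) r) (cplxJ (deriv (fun u' => (φ (u', r)).1) u)) := by
  classical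
  obtain ⟨κ, r, R, θ, Φ, -, hr, -, -, -, -, -, -, -, -, hcore, hpage, -, hder⟩ :=
    helper_exists_pageTube g c K hc hK hKc
  -- the squashing profile `sq x = (2/π) arctan x`
  obtain ⟨sq, hsq⟩ : ∃ sq : ℝ → ℝ, ∀ x, sq x = 2 / π * Real.arctan x := ⟨_, fun _ => rfl⟩
  have hsqeq : sq = fun x => 2 / π * Real.arctan x := funext hsq
  have hsqc : ContDiff ℝ ∞ sq := by rw [hsqeq]; exact contDiff_const.mul Real.contDiff_arctan
  have hsq0 : sq 0 = 0 := by rw [hsq, Real.arctan_zero, mul_zero]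
  have hπ2 : (0 : ℝ) < 2 / π := by positivity
  have hsq1 : ∀ x, |sq x| < 1 := fun x => by
    rw [hsq, abs_mul, abs_of_pos hπ2]
    have h3 : |Real.arctan x| < π / 2 :=
      abs_lt.2 ⟨by linarith [Real.neg_pi_div_two_lt_arctan x], Real.arctan_lt_pi_div_two x⟩
    calc 2 / π * |Real.arctan x| < 2 / π * (π / 2) := by gcongr
      _ = 1 := by field_simp
  have hsqi : Injective sq := fun x y h => by
    rw [hsq, hsq] at h
    exact Real.arctan_strictMono.injective (mul_left_cancel₀ hπ2.ne' h)
  have hsqd : HasDerivAt sq (2 / π) 0 := by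
    rw [hsqeq]
    have h := (Real.hasDerivAt_arctan 0).const_mul (2 / π)
    simpa using h
  -- the fibre vector `sq x • e₀`
  have hnormE0 : ‖(planeE0 : EuclideanSpace ℝ (Fin 2))‖ = 1 := by simp [planeE0]
  have hvnorm : ∀ x, ‖(sq x • planeE0 : EuclideanSpace ℝ (Fin 2))‖ < 1 := fun x => by
    rw [norm_smul, Real.norm_eq_abs, hnormE0, mul_one]; exact hsq1 x
  have hv1 : ∀ x, (sq x • planeE0 : EuclideanSpace ℝ (Fin 2)) 1 = 0 := fun x => by
    rw [PiLp.smul_apply, smul_eq_mul, planeE0_apply_one, mul_zero]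
  have hmemsrc : ∀ u x, ((circlePt u, sq x • planeE0) : sphere (0 : EuclideanSpace ℝ (Fin 2)) 1 ×
      EuclideanSpace ℝ (Fin 2)) ∈ Φ.toHomeo.source := fun u x => Φ.mem_source_iff.2 (hvnorm x)
  -- the un-thinned global chart `φ₀ (u, x) = incl (Φ (e^{2πiu}, sq x • e₀))`
  obtain ⟨φ₀, hφ₀⟩ : ∃ φ₀ : ℝ × ℝ → Base g, ∀ u x,
      φ₀ (u, x) = (bBase g).incl (Φ.toHomeo (circlePt u, sq x • planeE0)) :=
    ⟨fun p => (bBase g).incl (Φ.toHomeo (circlePt p.1, sq p.2 • planeE0)), fun _ _ => rfl⟩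
  have hφ₀eq : φ₀ = fun p => (bBase g).incl (Φ.toHomeo (circlePt p.1, sq p.2 • planeE0)) :=
    funext fun p => hφ₀ p.1 p.2
  have hφ₀s : ContMDiff 𝓘(ℝ, ℝ × ℝ) (𝓡∂ 4) ∞ φ₀ := by
    have hj : ContMDiff 𝓘(ℝ, ℝ × ℝ) ((𝓡 1).prod 𝓘(ℝ, EuclideanSpace ℝ (Fin 2))) ∞
        (fun p : ℝ × ℝ => ((circlePt p.1, sq p.2 • planeE0) :
          sphere (0 : EuclideanSpace ℝ (Fin 2)) 1 × EuclideanSpace ℝ (Fin 2))) := by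
      refine (contMDiff_circlePt.comp contDiff_fst.contMDiff).prodMk ?_
      have h2 : ContDiff ℝ ∞ (fun p : ℝ × ℝ => (sq p.2 • planeE0 : EuclideanSpace ℝ (Fin 2))) :=
        (hsqc.comp contDiff_snd).smul contDiff_const
      exact h2.contMDiff
    have hΦ := Φ.contMDiffOn_toHomeo.comp_contMDiff hj (fun p => hmemsrc p.1 p.2)
    have h := (bBase g).isSmoothEmbedding.contMDiff.comp hΦ
    rw [hφ₀eq]
    exact h
  have hφ₀1 : ∀ u x, φ₀ (u + 1, x) = φ₀ (u, x) := fun u x => by rw [hφ₀, hφ₀, circlePt_add_one]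
  have hφ₀a : ∀ u, φ₀ (u, 0) = K (circlePt u) := fun u => by
    rw [hφ₀, hsq0, zero_smul, ← CircleTube.core_apply, hcore]
  have hφ₀p : ∀ u x, φ₀ (u, x) ∈ page g c := fun u x => by
    have h := hpage (circlePt u) (sq x • planeE0) (hvnorm x)
    rw [hv1, Complex.ofReal_zero, mul_zero, Complex.exp_zero, one_mul] at h
    rwa [hφ₀]
  -- derivatives on the zero section: `∂ᵤφ₀ = K'`, `∂ₓφ₀ = (2/π) r · iK'`
  have hdu : ∀ u, deriv (fun u' => (φ₀ (u', 0)).1) u = deriv (ambCurve g K) u := fun u => by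
    have e : (fun u' => (φ₀ (u', 0)).1) = ambCurve g K := funext fun u' => by rw [hφ₀a]; rfl
    rw [e]
  have hdx : ∀ u, deriv (fun x => (φ₀ (u, x)).1) 0 = (2 / π * r) • cplxJ (deriv (ambCurve g K) u) := by
    intro u
    have hin : HasDerivAt (fun x => (sq x • planeE0 : EuclideanSpace ℝ (Fin 2))) ((2 / π) • planeE0) 0 :=
      hsqd.smul_const planeE0
    have hG : HasFDerivAt
        (fun v : EuclideanSpace ℝ (Fin 2) => ((bBase g).incl (Φ.toHomeo (circlePt u, v))).1)
        ((EuclideanSpace.proj (𝕜 := ℝ) (0 : Fin 2)).smulRight (r • cplxJ (deriv (ambCurve g K) u)) +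
          (EuclideanSpace.proj (𝕜 := ℝ) (1 : Fin 2)).smulRight (κ • rotField g (K (circlePt u)).1))
        (sq 0 • planeE0) := by
      rw [hsq0, zero_smul]; exact hder u
    have hcomp := HasFDerivAt.comp_hasDerivAt (x := (0 : ℝ))
      (f := fun x => (sq x • planeE0 : EuclideanSpace ℝ (Fin 2))) hG hin
    have e : ((fun v : EuclideanSpace ℝ (Fin 2) => ((bBase g).incl (Φ.toHomeo (circlePt u, v))).1) ∘
        fun x => (sq x • planeE0 : EuclideanSpace ℝ (Fin 2))) = fun x => (φ₀ (u, x)).1 :=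
      funext fun x => by simp only [Function.comp_apply, hφ₀]
    rw [e] at hcomp
    rw [hcomp.deriv]
    simp [ContinuousLinearMap.smulRight_apply, planeE0_apply_zero, planeE0_apply_one, smul_smul]
  have hpos0 : ∀ u, 0 < inner ℝ (deriv (fun x => (φ₀ (u, x)).1) 0)
      (cplxJ (deriv (fun u' => (φ₀ (u', 0)).1) u)) := fun u => by
    rw [hdx, hdu, real_inner_smul_left, inner_cplxJ_cplxJ]
    have h0 : 0 < ‖deriv (ambCurve g K) u‖ := norm_pos_iff.2 (deriv_ambCurve_ne_zero hK u)
    positivity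
  -- the orientation pairing `P`, continuous and `1`-periodic in `u`
  obtain ⟨P, hP⟩ : ∃ P : ℝ × ℝ → ℝ, ∀ p, P p =
      inner ℝ (fderiv ℝ (fun q : ℝ × ℝ => (φ₀ q).1) p ((0 : ℝ), (1 : ℝ)))
        (cplxJ (fderiv ℝ (fun q : ℝ × ℝ => (φ₀ q).1) p ((1 : ℝ), (0 : ℝ)))) := ⟨_, fun _ => rfl⟩
  have hPc : Continuous P := by
    rw [show P = _ from funext hP]
    have hF := continuous_fderiv_val hφ₀s
    exact (hF.clm_apply continuous_const).inner (continuous_cplxJ.comp (hF.clm_apply continuous_const))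
  have hPd : ∀ u x, P (u, x) =
      inner ℝ (deriv (fun x' => (φ₀ (u, x')).1) x) (cplxJ (deriv (fun u' => (φ₀ (u', x)).1) u)) :=
    fun u x => by rw [hP, deriv_val_r hφ₀s, deriv_val_u hφ₀s]
  have hP0 : ∀ u, 0 < P (u, 0) := fun u => by rw [hPd]; exact hpos0 u
  have hP1 : ∀ u x, P (u + 1, x) = P (u, x) := fun u x => by
    rw [hPd, hPd]
    have e1 : (fun x' => (φ₀ (u + 1, x')).1) = fun x' => (φ₀ (u, x')).1 := funext fun x' => by rw [hφ₀1]
    have e2 : deriv (fun u' => (φ₀ (u', x)).1) (u + 1) = deriv (fun u' => (φ₀ (u', x)).1) u := by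
      rw [← deriv_comp_add_const (fun u' => (φ₀ (u', x)).1) 1 u]
      exact congrArg (fun f : ℝ → EuclideanSpace ℝ (Fin 4) => deriv f u) (funext fun u' => by rw [hφ₀1])
    rw [e1, e2]
  -- a uniform width `ε` of positivity (generalized tube lemma + periodicity)
  obtain ⟨ε, hε, hεP⟩ : ∃ ε > 0, ∀ u x, |x| < ε → 0 < P (u, x) := by
    have hUo : IsOpen {p : ℝ × ℝ | 0 < P p} := isOpen_lt continuous_const hPc
    have hsub : Icc (0 : ℝ) 1 ×ˢ ({0} : Set ℝ) ⊆ {p : ℝ × ℝ | 0 < P p} := by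
      rintro ⟨u, x⟩ ⟨-, hx⟩
      rw [mem_singleton_iff] at hx
      subst hx
      exact hP0 u
    obtain ⟨U, V, -, hVo, hU, hV, hUV⟩ :=
      generalized_tube_lemma isCompact_Icc isCompact_singleton hUo hsub
    obtain ⟨ε, hε, hball⟩ := Metric.isOpen_iff.1 hVo 0 (hV (mem_singleton 0))
    refine ⟨ε, hε, fun u x hx => ?_⟩
    have hxV : x ∈ V := hball (by rw [mem_ball, Real.dist_0_eq_abs]; exact hx)
    have hper : Function.Periodic (fun u => P (u, x)) 1 := fun u => hP1 u x
    have e : P (Int.fract u, x) = P (u, x) := by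
      have h := (hper.int_mul (-⌊u⌋)) u
      simp only [Int.cast_neg, mul_one] at h
      rw [Int.fract, sub_eq_add_neg]
      exact h
    rw [← e]
    exact hUV (mk_mem_prod (hU ⟨Int.fract_nonneg u, (Int.fract_lt_one u).le⟩) hxV)
  -- the thinned chart `φ (u, x) = φ₀ (u, ε x)`
  obtain ⟨φ, hφ⟩ : ∃ φ : ℝ × ℝ → Base g, ∀ u x, φ (u, x) = φ₀ (u, ε * x) :=
    ⟨fun p => φ₀ (p.1, ε * p.2), fun _ _ => rfl⟩
  have hφeq : φ = fun p => φ₀ (p.1, ε * p.2) := funext fun p => hφ p.1 p.2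
  refine ⟨φ, ?_, fun u x => ?_, fun u => ?_, fun p => ?_, ?_, fun u x hx => ?_⟩
  · rw [hφeq]
    exact hφ₀s.comp (contDiff_fst.prodMk (contDiff_const.mul contDiff_snd)).contMDiff
  · rw [hφ, hφ, hφ₀1]
  · rw [hφ, mul_zero, hφ₀a]
  · rw [show p = (p.1, p.2) from rfl, hφ]
    exact hφ₀p _ _
  · rintro ⟨u, x⟩ ⟨hu, -⟩ ⟨u', x'⟩ ⟨hu', -⟩ h
    have h0 : φ (u, x) = φ (u', x') := h
    rw [hφ, hφ, hφ₀, hφ₀] at h0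
    have h2 := Φ.toHomeo.injOn (hmemsrc _ _) (hmemsrc _ _) ((bBase g).injective_incl h0)
    simp only [Prod.mk.injEq] at h2
    obtain ⟨hcu, hsv⟩ := h2
    have hu_eq : u = u' := by
      obtain ⟨m, hm⟩ := circlePt_eq_circlePt_iff.1 hcu
      have hm0 : m = 0 := int_eq_zero_of_abs_cast_lt_one (abs_lt.2
        ⟨by linarith [hu.1, hu'.2], by linarith [hu.2, hu'.1]⟩)
      rw [hm0, Int.cast_zero, add_zero] at hm
      exact hm
    have hx_eq : x = x' := by
      have h3 : (sq (ε * x) • planeE0 : EuclideanSpace ℝ (Fin 2)) 0 =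
          (sq (ε * x') • planeE0 : EuclideanSpace ℝ (Fin 2)) 0 := by rw [hsv]
      simp only [PiLp.smul_apply, smul_eq_mul, planeE0_apply_zero, mul_one] at h3
      exact mul_left_cancel₀ hε.ne' (hsqi h3)
    rw [hu_eq, hx_eq]
  · have e1 : deriv (fun r' => (φ (u, r')).1) x = ε • deriv (fun x' => (φ₀ (u, x')).1) (ε * x) := by
      have e : (fun r' => (φ (u, r')).1) = fun r' => (fun x' => (φ₀ (u, x')).1) (ε * r') :=
        funext fun r' => by rw [hφ]
      rw [e, deriv_comp_mul_left ε (fun x' => (φ₀ (u, x')).1) x]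
    have e2 : (fun u' => (φ (u', x)).1) = fun u' => (φ₀ (u', ε * x)).1 := funext fun u' => by rw [hφ]
    rw [e1, e2, real_inner_smul_left, ← hPd]
    have hεx : |ε * x| < ε := by
      rw [abs_mul, abs_of_pos hε]
      have := abs_lt.2 ⟨hx.1, hx.2⟩
      nlinarith
    exact mul_pos hε (hεP u (ε * x) hεx)

/-! ## §2 Consequences: N3b′ for smoothly embedded page curves and for Lefschetz links -/

/-- **The shadow of a smoothly embedded page curve is zero or primitive** (N3b′ + the chart of §1).
[cite: FarbMargalit2012, Prop. 6.2] -/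
theorem shadow_eq_zero_or_isPrimitive_of_isSmoothEmbedding (hc : ‖c‖ = 1)
    (hK : Manifold.IsSmoothEmbedding (𝓡 1) (𝓡∂ 4) ∞ K) (hKc : ∀ θ, K θ ∈ page g c) :
    shadow g K hK.contMDiff.continuous = 0 ∨ IsPrimitive (shadow g K hK.contMDiff.continuous) := by
  obtain ⟨φ, hφs, hφ1, hφa, hφp, hφi, hφo⟩ := exists_chart_of_isSmoothEmbedding hc hK hKc
  exact shadow_eq_zero_or_isPrimitive hc hK.contMDiff.continuous hφs hφ1 hφa hφp hφi hφo

/-- **A smoothly embedded page curve with non-zero class has a dual page loop**: some loop `L` of the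
page has `stdSymp ℤ g (shadow K) (shadow L) = 1`. [cite: FarbMargalit2012, §6.1] -/
theorem exists_pageLoop_stdSymp_eq_one_of_isSmoothEmbedding (hc : ‖c‖ = 1)
    (hK : Manifold.IsSmoothEmbedding (𝓡 1) (𝓡∂ 4) ∞ K) (hKc : ∀ θ, K θ ∈ page g c)
    (hv : shadow g K hK.contMDiff.continuous ≠ 0) :
    ∃ (L : sphere (0 : EuclideanSpace ℝ (Fin 2)) 1 → Base g) (hL : Continuous L),
      (∀ θ, L θ ∈ page g c) ∧ stdSymp ℤ g (shadow g K hK.contMDiff.continuous) (shadow g L hL) = 1 := by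
  obtain ⟨φ, hφs, hφ1, hφa, hφp, hφi, hφo⟩ := exists_chart_of_isSmoothEmbedding hc hK hKc
  obtain ⟨L, hL, hLc, -, h1⟩ :=
    exists_pageLoop_stdSymp_eq_one hc hK.contMDiff.continuous hφs hφ1 hφa hφp hφi hφo hv
  exact ⟨L, hL, hLc, h1⟩

/-- **Every letter of a word realised by a Lefschetz link is `0` or primitive** (the attaching circles
are smoothly embedded page curves with the letters as shadows). [cite: FarbMargalit2012, Prop. 6.2] -/
theorem IsLefschetzLink.fst_eq_zero_or_isPrimitive {l : IntWord g}
    {h : Fin l.length → HandleAttachingMap 3 2 (Base g)} (hl : IsLefschetzLink g l h) (i : Fin l.length) :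
    (l.get i).1 = 0 ∨ IsPrimitive (l.get i).1 := by
  rw [← hl.shadow_eq i]
  exact shadow_eq_zero_or_isPrimitive_of_isSmoothEmbedding (norm_pageDir _ _)
    (isSmoothEmbedding_attachingCircle (h i)) (hl.mem_page i)

/-! ## §3 The registered form -/

/-- **Sub-goal `helper_exists_chart_of_isSmoothEmbedding`** (G7-5 = node N3b″ of the repair of N3b of
NF4): every smooth embedding of the circle into a page of the Lefschetz base is the core of a
positively oriented smooth annulus chart (the six hypotheses of node N1a), in registered form.
[cite: Kosinski1993, III (3.1)] -/
theorem helper_exists_chart_of_isSmoothEmbedding : ∀ (g : ℕ) (c : ℂ) (_hc : ‖c‖ = 1) (K : Metric.sphere (0 : EuclideanSpace ℝ (Fin 2)) 1 → Literature.Topology.FourManifolds.LefschetzBase.Base g), Manifold.IsSmoothEmbedding (𝓡 1) (𝓡∂ 4) ∞ K → (∀ θ, K θ ∈ Literature.Topology.FourManifolds.LefschetzBase.page g c) → ∃ φ : ℝ × ℝ → Literature.Topology.FourManifolds.LefschetzBase.Base g, ContMDiff 𝓘(ℝ, ℝ × ℝ) (𝓡∂ 4) ∞ φ ∧ (∀ u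 r, φ (u + 1, r) = φ (u, r)) ∧ (∀ u, φ (u, 0) = K (Literature.Topology.FourManifolds.circlePt u)) ∧ (∀ p, φ p ∈ Literature.Topology.FourManifolds.LefschetzBase.page g c) ∧ Set.InjOn φ (Set.Ico (0 : ℝ) 1 ×ˢ Set.Ioo (-1 : ℝ) 1) ∧ ∀ u r, r ∈ Set.Ioo (-1 : ℝ) 1 → 0 < inner ℝ (deriv (fun r' => (φ (u, r')).1) r) (Literature.Topology.FourManifolds.LefschetzBase.cplxJ (deriv (fun u' => (φ (u', r)).1) u)) :=
  fun _ _ hc _ hK hKc => exists_chart_of_isSmoothEmbedding hc hK hKc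

end Summit.SmoothPoincare4.SmoothPoincare4.Theorems.AcyclicBisectionExists.ModpBraidOrbits

end
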